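import Mathlib.NumberTheory.Zsqrtd.GaussianInt
import Mathlib.NumberTheory.Padics.PadicVal.Basic
import Mathlib.Tactic.IntervalCases
import Mathlib.Tactic.Linarith
import Mathlib.Tactic.Ring
import Mathlib.Tactic.LinearCombination
import Literature.NumberTheory.QuadraticFields.GaussianMinimalEuclideanFunction
import Literature.NumberTheory.QuadraticFields.ImaginaryQuadraticUniversalSideDivisors
import HarnessLib

/-!
# Gauss remainders and the minimal Euclidean function of `ℤ[i]`: the norms `ℓ∞`, `ℓ1`, `m`, the valuation
# `v₂`, the units `u_z`, Lemma 3.2, Lemma 4.1 (Graves 2025, §§1–4)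

Topic `Literature/NumberTheory/QuadraticFields`, namespace `Literature.NumberTheory.QuadraticFields.GaussianDigits`
(continuing `GaussianDigitExpansions.lean` / `GaussianMinimalEuclideanFunction.lean`: `digitSet n = B_n`,
`width n = w_n`, and `φ_{ℤ[i]} = motzkinNorm forall_exists_not_mem_motzkinSet`, for which
`φ(z) ≤ n ↔ z ∈ B_n` (`motzkinNorm_le_iff_mem_digitSet`, [Graves2023] Thm. 5.3)).  First of two files
formalising H. Graves, *A division algorithm for the Gaussian integers' minimal Euclidean function*, Canad. Math.
Bull. **69** (2025) 688–701 [Graves2025]; the second (`GaussianMinimalEuclideanDivisionAlgorithm.lean`) proves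
§§5–6 and Theorem 1.5.  EIGHT DEFINITIONS WITH BODIES (`supNorm` = `ℓ∞`, `oneNorm` = `ℓ1`, `minAbs` = `m`,
`twoVal` = `v₂`, `InNormalCone`, `normalUnit` = `u_z`, `imSign` = `s(r)`, `IsGaussRemainder`), everything else
PROVED; no named fact, no instance, no notation.

## Source (read at the page; materialised `paper:arxiv-2502.21136`, pp. 2–4)

VERBATIM: §1 «The `ℓ₁`-norm is `ℓ₁(x+yi) = |x| + |y|` and the `ℓ_∞`-norm is `ℓ_∞(x+yi) = max(|x|, |y|)` …
`m(x+yi) = ℓ₁(x+yi) − ℓ_∞(x+yi) = min(|x|, |y|)`»; «`j = v₂(gcd(x,y))`», written `v₂(z)`; «We rely on the facts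
that `w_{m+2} = 2w_m` and that if `2^l < w_n`, then `2^l ∣ w_m` for all `m > n`.»
* Theorem 1.1 (= [Graves2023]): `φ_{ℤ[i]}(x+yi) = n + 2j` or `n + 2j + 1` according to the bounds
  `|x|/2^j, |y|/2^j ≤ w_n − 2`, `(|x|+|y|)/2^j ≤ w_{n+1} − 3` — here `mem_digitSet_iff_supNorm_le`:
  `z ∈ B_n ↔ ℓ∞(z) ≤ w_n − 2^{v₂(z)+1} ∧ ℓ1(z) ≤ w_{n+1} − 3·2^{v₂(z)}` (Theorem 2.5 of [Graves2023], tree).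
* Definition 1.2: «If `ℓ_∞(z) ≠ m(z)`, there exists a unique unit `u_z` such that `Re(u_z z) = ℓ_∞(z)`.  If
  `ℓ_∞(z) = m(z)`, there exists a unique unit `u_z` such that `u_z z = ℓ_∞(z)(1+i)`.» (e.g. `u_{−1+2i} = −i`,
  `u_{1−i} = i`) — `normalUnit`; both cases say: `u_z z` lies in the cone `−Re < Im ≤ Re` (`InNormalCone`).
* Corollary 1.3 (three sentences) — `mem_digitSet_of_supNorm_le`, `not_mem_digitSet_iff_lt`,
  `minAbs_le_of_mem_digitSet_succ` (the printed `2^{v₂(x)}` is a misprint for `2^{v₂(z)}`).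
* Definition 1.4: `s(r) = sgn(Im(u_r r))` — `imSign`.
* §3 (Gauss's division algorithm): `a/b = (q₀ + q₁ i) + (f₀ + f₁ i)` with `|f₀|, |f₁| ≤ 1/2`; «We call `q₀ + q₁ i`
  the Gauss quotient … and `(f₀ + f₁ i) b` the Gauss remainder.»  Lemma 3.1 (scaling by `z`), Lemma 3.2: «If
  `a, b` have Gauss remainder `r` and `φ(b) = n`, then `ℓ₁(r) ≤ ℓ_∞(b) < w_n` and `ℓ_∞(r) ≤ ℓ₁(b)/2 < w_{n−1}`.»
* Lemma 4.1: «If … Gauss remainder `r` and `v₂(r) ≤ v₂(b)`, then `φ(r) < φ(b) = n`.»  Corollary 4.2: «… and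
  `v₂(a) ≤ v₂(b)`, then `φ(r) < φ(b)`.»

## Dictionary and design

* `φ(z) ≤ n ↔ z ∈ B_n` (`z ≠ 0`), so «`φ(r) ≥ φ(b) = n`» is rendered by `b ∈ B_{k+1}`, `r ∉ B_k` (`n = k+1`) and
  «`φ(r) < φ(b)`» by `r ∈ B_k`; `φ`-versions are derived at the end of each section.
* `IsGaussRemainder b r := 2|Re(r b̄)| ≤ N(b) ∧ 2|Im(r b̄)| ≤ N(b)` — `r/b` lies in the closed square of side 1
  around `0`.  This is the property of the printed Gauss remainder that the paper uses; it does not fix the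
  tie-breaking of `⌊·⌉`, and Mathlib's `a % b` (which rounds halves up) satisfies it (`isGaussRemainder_mod`,
  with `a = (a / b) b + a % b`, `div_mul_add_mod_eq`).  All results below hold for every such `r`.
* `twoVal z := padicValNat 2 (gcd (re z) (im z))`, characterised by exactness (`twoVal_eq`,
  `pow_dvd_iff_le_twoVal`); `v₂(0) = 0`.

## Deviations from the printed text (all documented at the declarations)

* Lemma 3.2's rider «Equality occurs only if `r/b ∈ ±½{1, i, 1 ± i}`» is false as printed (`b = 3+3i`,
  `r = 1+2i`: `ℓ1(r) = ℓ∞(b)` with `r/b = 1/2 + i/6`; `b = 4`, `r = 2+i`: `ℓ∞(r) = ℓ1(b)/2` with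
  `r/b = 1/2 + i/4`).  It is replaced by what the later proofs need: the strict inequalities when `r/b` is in the
  open square (`oneNorm_lt_supNorm_of_lt`), in particular when `N(b)` is odd, and — in the second file —
  Corollary 3.3 itself, proved through Lemma 4.1 and a parity argument.
* Lemma 4.1 is proved by dividing by `2^{v₂(r)}` (Lemma 3.1) and a parity/odd-norm argument instead of the
  printed appeal to that rider.
* Corollary 4.2 needs `v₂(a) < v₂(b)` (STRICT); with `≤` it is false: `a = −177−177i`, `b = −12−11i`, Gauss
  quotient `15+i`, remainder `−8`, `v₂(a) = v₂(b) = 0`, `φ(−8) = φ(b) = 6` (`corollary_4_2_counterexample`).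
* The printed statements were checked by machine before formalisation (all pairs `(b, r)` with
  `|Re b|, |Im b| ≤ 48`, `r` in the closed Gauss square: 14.8·10⁶ pairs, 69 440 with `φ(r) ≥ φ(b)`; no exception
  to Theorem 1.1, Corollary 1.3, Lemmas 3.2 (inequalities), 4.1, 5.1–5.4, 6.1–6.5, Proposition 5.5, Theorem 1.5).

## Main statements

`mem_digitSet_iff_supNorm_le` / `motzkinNorm_le_iff_supNorm_le` (Thm. 1.1), `mem_digitSet_of_supNorm_le`,
`not_mem_digitSet_iff_lt`, `minAbs_le_of_mem_digitSet_succ` (Cor. 1.3), `two_pow_dvd_width_of_lt` (§1),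
`inNormalCone_normalUnit_mul` / `normalUnit_eq_of_inNormalCone` (Def. 1.2: existence and uniqueness of `u_z`),
`isGaussRemainder_mod` (§3), `isGaussRemainder_mul_iff` (Lemma 3.1), `IsGaussRemainder.oneNorm_le` /
`….oneNorm_lt_width` / `….two_mul_supNorm_lt_width` (Lemma 3.2), **`IsGaussRemainder.mem_digitSet_of_twoVal_le`**
/ `….motzkinNorm_lt_of_twoVal_le` (Lemma 4.1), `IsGaussRemainder.mem_digitSet_of_twoVal_lt` (Cor. 4.2, corrected).

## Mathlib / tree search

Mathlib: `GaussianInt` (`ℤ√(-1)`) with `div_def`/`mod_def` (nearest-integer rounding, `round`, `abs_sub_round`),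
`Zsqrtd.norm_eq_mul_conj`, `Zsqrtd.intCast_dvd`, `padicValNat` (`pow_padicValNat_dvd`,
`pow_succ_padicValNat_not_dvd`), `Int.gcd`; no `ℓ∞`/`ℓ1` API for `ℤ√d` (`lean search 'supNorm|linfty' --decl`:
nothing for `Zsqrtd`).  Tree: `GaussianDigitExpansions` (Theorem 2.5 in the exact-valuation form
`mem_digitSet_iff_of_exact`, `two_pow_mul_mem_digitSet_iff`, `eq_two_pow_mul`), `GaussianMinimalEuclideanFunction`
(`motzkinNorm_le_iff_mem_digitSet`), `ImaginaryQuadraticUniversalSideDivisors` (`ZSqrt.isUnit_iff_neg_one`).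
-/

namespace Literature.NumberTheory.QuadraticFields.GaussianDigits

open _root_.Zsqrtd Literature.Algebra.EuclideanDomain

/-! ## §1 The norms `ℓ∞`, `ℓ1` and `m = ℓ1 − ℓ∞` -/

/-- `ℓ∞(x+yi) = max(|x|, |y|)`. [cite: Graves2025, §1 (p. 2)] -/
def supNorm (z : ℤ√(-1)) : ℤ := max |z.re| |z.im|

/-- `ℓ1(x+yi) = |x| + |y|`. [cite: Graves2025, §1 (p. 2)] -/
def oneNorm (z : ℤ√(-1)) : ℤ := |z.re| + |z.im|

/-- `m(x+yi) = ℓ1(x+yi) − ℓ∞(x+yi) = min(|x|, |y|)`. [cite: Graves2025, §1 (p. 2)] -/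
def minAbs (z : ℤ√(-1)) : ℤ := min |z.re| |z.im|

/-- Unfolding `ℓ∞`. [cite: Graves2025, §1 (p. 2)] -/
theorem supNorm_def (z : ℤ√(-1)) : supNorm z = max |z.re| |z.im| := rfl

/-- Unfolding `ℓ1`. [cite: Graves2025, §1 (p. 2)] -/
theorem oneNorm_def (z : ℤ√(-1)) : oneNorm z = |z.re| + |z.im| := rfl

/-- Unfolding `m`. [cite: Graves2025, §1 (p. 2)] -/
theorem minAbs_def (z : ℤ√(-1)) : minAbs z = min |z.re| |z.im| := rfl

/-- `m(z) = ℓ1(z) − ℓ∞(z)`, as printed. [cite: Graves2025, §1 (p. 2)] -/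
theorem minAbs_eq_oneNorm_sub_supNorm (z : ℤ√(-1)) : minAbs z = oneNorm z - supNorm z := by
  have h := max_add_min |z.re| |z.im|
  unfold minAbs oneNorm supNorm
  omega

/-- `ℓ1 = ℓ∞ + m`. [cite: Graves2025, §1 (p. 2)] -/
theorem oneNorm_eq_supNorm_add_minAbs (z : ℤ√(-1)) : oneNorm z = supNorm z + minAbs z := by
  rw [minAbs_eq_oneNorm_sub_supNorm]; ring

/-- `0 ≤ m(z)`. [cite: Graves2025, §1 (p. 2)] -/
theorem minAbs_nonneg (z : ℤ√(-1)) : 0 ≤ minAbs z := le_min (abs_nonneg _) (abs_nonneg _)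

/-- `m(z) ≤ ℓ∞(z)`. [cite: Graves2025, §1 (p. 2)] -/
theorem minAbs_le_supNorm (z : ℤ√(-1)) : minAbs z ≤ supNorm z := min_le_max

/-- `0 ≤ ℓ∞(z)`. [cite: Graves2025, §1 (p. 2)] -/
theorem supNorm_nonneg (z : ℤ√(-1)) : 0 ≤ supNorm z := le_max_of_le_left (abs_nonneg _)

/-- `ℓ∞(z) > 0` for `z ≠ 0`. [cite: Graves2025, §1 (p. 2)] -/
theorem supNorm_pos {z : ℤ√(-1)} (hz : z ≠ 0) : 0 < supNorm z := by
  have h : ¬(z.re = 0 ∧ z.im = 0) := fun h ↦ hz (Zsqrtd.ext h.1 h.2)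
  unfold supNorm
  rcases abs_cases z.re with ⟨h1, _⟩ | ⟨h1, _⟩ <;> rcases abs_cases z.im with ⟨h2, _⟩ | ⟨h2, _⟩ <;> omega

/-- `ℓ∞(z) = 0 ↔ z = 0`. [cite: Graves2025, §1 (p. 2)] -/
theorem supNorm_eq_zero_iff {z : ℤ√(-1)} : supNorm z = 0 ↔ z = 0 := by
  constructor
  · intro h
    by_contra hz
    exact absurd h (supNorm_pos hz).ne'
  · rintro rfl
    simp [supNorm]

/-- `2 m(z) ≤ ℓ1(z)`. [cite: Graves2025, §5.1 (p. 5)] -/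
theorem two_mul_minAbs_le_oneNorm (z : ℤ√(-1)) : 2 * minAbs z ≤ oneNorm z := by
  rw [oneNorm_eq_supNorm_add_minAbs]; linarith [minAbs_le_supNorm z]

/-- Coordinate bounds: `|re z|, |im z| ≤ ℓ∞(z)`. [cite: Graves2025, §1 (p. 2)] -/
theorem abs_re_le_supNorm (z : ℤ√(-1)) : |z.re| ≤ supNorm z := le_max_left _ _

/-- Coordinate bounds: `|im z| ≤ ℓ∞(z)`. [cite: Graves2025, §1 (p. 2)] -/
theorem abs_im_le_supNorm (z : ℤ√(-1)) : |z.im| ≤ supNorm z := le_max_right _ _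

/-- The units of `ℤ[i]` permute `(|re|, |im|)`. [cite: Graves2025, §2 (p. 3)] -/
theorem abs_re_im_unit_mul {u : ℤ√(-1)} (hu : IsUnit u) (z : ℤ√(-1)) :
    (|(u * z).re| = |z.re| ∧ |(u * z).im| = |z.im|) ∨ (|(u * z).re| = |z.im| ∧ |(u * z).im| = |z.re|) := by
  rcases ZSqrt.isUnit_iff_neg_one.mp hu with rfl | rfl | rfl | rfl
  · left; simp
  · left; simp
  · right; simp [Zsqrtd.re_mul, Zsqrtd.im_mul, abs_neg]
  · right; simp [Zsqrtd.re_mul, Zsqrtd.im_mul, abs_neg]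

/-- «Both the norm and `φ_{ℤ[i]}` are invariant under multiplication by units»; so are `ℓ∞`, `ℓ1`, `m`:
`ℓ∞(uz) = ℓ∞(z)`. [cite: Graves2025, §2 (p. 3)] -/
theorem supNorm_unit_mul {u : ℤ√(-1)} (hu : IsUnit u) (z : ℤ√(-1)) : supNorm (u * z) = supNorm z := by
  unfold supNorm
  rcases abs_re_im_unit_mul hu z with ⟨h1, h2⟩ | ⟨h1, h2⟩ <;> rw [h1, h2]
  exact max_comm _ _

/-- `ℓ1(uz) = ℓ1(z)` for a unit `u`. [cite: Graves2025, §2 (p. 3)] -/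
theorem oneNorm_unit_mul {u : ℤ√(-1)} (hu : IsUnit u) (z : ℤ√(-1)) : oneNorm (u * z) = oneNorm z := by
  unfold oneNorm
  rcases abs_re_im_unit_mul hu z with ⟨h1, h2⟩ | ⟨h1, h2⟩ <;> rw [h1, h2]
  exact add_comm _ _

/-- `m(uz) = m(z)` for a unit `u`. [cite: Graves2025, §2 (p. 3)] -/
theorem minAbs_unit_mul {u : ℤ√(-1)} (hu : IsUnit u) (z : ℤ√(-1)) : minAbs (u * z) = minAbs z := by
  rw [minAbs_eq_oneNorm_sub_supNorm, minAbs_eq_oneNorm_sub_supNorm, oneNorm_unit_mul hu,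
    supNorm_unit_mul hu]

/-- `ℓ∞(−z) = ℓ∞(z)`. [cite: Graves2025, §2 (p. 3)] -/
theorem supNorm_neg (z : ℤ√(-1)) : supNorm (-z) = supNorm z := by simp [supNorm]

/-- `ℓ1(−z) = ℓ1(z)`. [cite: Graves2025, §2 (p. 3)] -/
theorem oneNorm_neg (z : ℤ√(-1)) : oneNorm (-z) = oneNorm z := by simp [oneNorm]

/-- `m(−z) = m(z)`. [cite: Graves2025, §2 (p. 3)] -/
theorem minAbs_neg (z : ℤ√(-1)) : minAbs (-z) = minAbs z := by simp [minAbs]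

/-- `ℓ∞(2^j z) = 2^j ℓ∞(z)` (coordinatewise scaling by a non-negative integer). [cite: Graves2025, Thm. 1.1 (p. 2)] -/
theorem supNorm_intCast_mul {P : ℤ} (hP : 0 ≤ P) (z : ℤ√(-1)) : supNorm ((P : ℤ√(-1)) * z) = P * supNorm z := by
  unfold supNorm
  rw [Zsqrtd.re_smul, Zsqrtd.im_smul, abs_mul, abs_mul, abs_of_nonneg hP]
  exact (mul_max_of_nonneg _ _ hP).symm

/-- `ℓ1(P z) = P ℓ1(z)` for `P ≥ 0`. [cite: Graves2025, Thm. 1.1 (p. 2)] -/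
theorem oneNorm_intCast_mul {P : ℤ} (hP : 0 ≤ P) (z : ℤ√(-1)) : oneNorm ((P : ℤ√(-1)) * z) = P * oneNorm z := by
  unfold oneNorm
  rw [Zsqrtd.re_smul, Zsqrtd.im_smul, abs_mul, abs_mul, abs_of_nonneg hP]; ring

/-- `m(P z) = P m(z)` for `P ≥ 0`. [cite: Graves2025, Thm. 1.1 (p. 2)] -/
theorem minAbs_intCast_mul {P : ℤ} (hP : 0 ≤ P) (z : ℤ√(-1)) : minAbs ((P : ℤ√(-1)) * z) = P * minAbs z := by
  rw [minAbs_eq_oneNorm_sub_supNorm, minAbs_eq_oneNorm_sub_supNorm, oneNorm_intCast_mul hP,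
    supNorm_intCast_mul hP]; ring

/-! ## §2 The `2`-valuation `v₂(x+yi) = v₂(gcd(x,y))` -/

/-- `v₂(x+yi) := v₂(gcd(x, y))`: the exponent of the exact power of `2` dividing both coordinates
(`v₂(0) = 0` by convention). [cite: Graves2025, Thm. 1.1 (p. 2)] -/
def twoVal (z : ℤ√(-1)) : ℕ := padicValNat 2 (Int.gcd z.re z.im)

/-- `2^{v₂(z)}` divides both coordinates. [cite: Graves2025, Thm. 1.1 (p. 2)] -/
theorem pow_twoVal_dvd (z : ℤ√(-1)) : (2 : ℤ) ^ twoVal z ∣ z.re ∧ (2 : ℤ) ^ twoVal z ∣ z.im := by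
  have h : ((2 ^ twoVal z : ℕ) : ℤ) ∣ (Int.gcd z.re z.im : ℤ) := Int.natCast_dvd_natCast.mpr pow_padicValNat_dvd
  push_cast at h
  exact ⟨h.trans (Int.gcd_dvd_left _ _), h.trans (Int.gcd_dvd_right _ _)⟩

/-- `2^{v₂(z)+1}` does not divide both coordinates of `z ≠ 0`. [cite: Graves2025, Thm. 1.1 (p. 2)] -/
theorem not_pow_twoVal_succ_dvd {z : ℤ√(-1)} (hz : z ≠ 0) :
    ¬((2 : ℤ) ^ (twoVal z + 1) ∣ z.re ∧ (2 : ℤ) ^ (twoVal z + 1) ∣ z.im) := by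
  rintro ⟨h1, h2⟩
  have hg : Int.gcd z.re z.im ≠ 0 := fun h ↦
    hz (Zsqrtd.ext (Int.gcd_eq_zero_iff.mp h).1 (Int.gcd_eq_zero_iff.mp h).2)
  have h := Int.dvd_coe_gcd h1 h2
  have h' : 2 ^ (twoVal z + 1) ∣ Int.gcd z.re z.im := by exact_mod_cast h
  exact pow_succ_padicValNat_not_dvd hg h'

/-- `v₂` is characterised by exactness: `2^k ∥ (re z, im z) ⇒ v₂(z) = k`. [cite: Graves2025, Thm. 1.1 (p. 2)] -/
theorem twoVal_eq {z : ℤ√(-1)} {k : ℕ} (hz : z ≠ 0) (hk : (2 : ℤ) ^ k ∣ z.re ∧ (2 : ℤ) ^ k ∣ z.im)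
    (hk' : ¬((2 : ℤ) ^ (k + 1) ∣ z.re ∧ (2 : ℤ) ^ (k + 1) ∣ z.im)) : twoVal z = k :=
  exact_two_pow_unique (pow_twoVal_dvd z) (not_pow_twoVal_succ_dvd hz) hk hk'

/-- `2^k` divides both coordinates of `z ≠ 0` iff `k ≤ v₂(z)`. [cite: Graves2025, Thm. 1.1 (p. 2)] -/
theorem pow_dvd_iff_le_twoVal {z : ℤ√(-1)} (hz : z ≠ 0) {k : ℕ} :
    ((2 : ℤ) ^ k ∣ z.re ∧ (2 : ℤ) ^ k ∣ z.im) ↔ k ≤ twoVal z := by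
  constructor
  · intro h
    by_contra hlt
    have hd : (2 : ℤ) ^ (twoVal z + 1) ∣ 2 ^ k := pow_dvd_pow 2 (by omega)
    exact not_pow_twoVal_succ_dvd hz ⟨hd.trans h.1, hd.trans h.2⟩
  · intro h
    have hd : (2 : ℤ) ^ k ∣ 2 ^ twoVal z := pow_dvd_pow 2 h
    exact ⟨hd.trans (pow_twoVal_dvd z).1, hd.trans (pow_twoVal_dvd z).2⟩

/-- `v₂(z) = 0` iff the coordinates are not both even. [cite: Graves2025, §2 (p. 3)] -/
theorem twoVal_eq_zero_iff {z : ℤ√(-1)} (hz : z ≠ 0) : twoVal z = 0 ↔ ¬(2 ∣ z.re ∧ 2 ∣ z.im) := by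
  rw [← Nat.le_zero, ← not_lt, not_iff_not, show (0 < twoVal z) ↔ 1 ≤ twoVal z from Iff.rfl,
    ← pow_dvd_iff_le_twoVal hz, pow_one]

/-- «Both the norm and `φ` are invariant under multiplication by units» — so is `v₂`. [cite: Graves2025, §2 (p. 3)] -/
theorem twoVal_unit_mul {u : ℤ√(-1)} (hu : IsUnit u) (z : ℤ√(-1)) : twoVal (u * z) = twoVal z := by
  by_cases hz : z = 0
  · subst hz; simp
  have huz : u * z ≠ 0 := mul_ne_zero hu.ne_zero hz
  apply twoVal_eq huz
  · rw [← Zsqrtd.intCast_dvd, hu.dvd_mul_left, Zsqrtd.intCast_dvd]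
    exact pow_twoVal_dvd z
  · rw [← Zsqrtd.intCast_dvd, hu.dvd_mul_left, Zsqrtd.intCast_dvd]
    exact not_pow_twoVal_succ_dvd hz

/-- `v₂(−z) = v₂(z)`. [cite: Graves2025, §2 (p. 3)] -/
theorem twoVal_neg (z : ℤ√(-1)) : twoVal (-z) = twoVal z := by
  rw [← neg_one_mul]; exact twoVal_unit_mul isUnit_one.neg z

/-- `v₂(2^j z) = v₂(z) + j` for `z ≠ 0`. [cite: Graves2025, Thm. 1.1 (p. 2)] -/
theorem twoVal_two_pow_mul {z : ℤ√(-1)} (hz : z ≠ 0) (j : ℕ) : twoVal (2 ^ j * z) = twoVal z + j := by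
  have hz' : (2 : ℤ√(-1)) ^ j * z ≠ 0 := mul_ne_zero (pow_ne_zero _ (by decide)) hz
  have hre : ((2 : ℤ√(-1)) ^ j * z).re = 2 ^ j * z.re := by
    rw [show ((2 : ℤ√(-1)) ^ j) = ((2 ^ j : ℤ) : ℤ√(-1)) by push_cast; rfl, Zsqrtd.re_smul]
  have him : ((2 : ℤ√(-1)) ^ j * z).im = 2 ^ j * z.im := by
    rw [show ((2 : ℤ√(-1)) ^ j) = ((2 ^ j : ℤ) : ℤ√(-1)) by push_cast; rfl, Zsqrtd.im_smul]
  apply twoVal_eq hz'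
  · rw [hre, him, pow_add, mul_comm ((2 : ℤ) ^ twoVal z)]
    exact ⟨mul_dvd_mul_left _ (pow_twoVal_dvd z).1, mul_dvd_mul_left _ (pow_twoVal_dvd z).2⟩
  · rw [hre, him, show twoVal z + j + 1 = j + (twoVal z + 1) by ring, pow_add]
    rintro ⟨h1, h2⟩
    have hP : (2 : ℤ) ^ j ≠ 0 := pow_ne_zero _ (by norm_num)
    exact not_pow_twoVal_succ_dvd hz ⟨(mul_dvd_mul_iff_left hP).mp h1, (mul_dvd_mul_iff_left hP).mp h2⟩

/-! ## §3 Widths and powers of two -/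

/-- `2^{⌈m/2⌉} ∣ w_m` (`w_{2a} = 3·2^a`, `w_{2a+1} = 4·2^a`). [cite: Graves2025, §1 (p. 2)] -/
theorem two_pow_dvd_width (m : ℕ) : (2 : ℤ) ^ ((m + 1) / 2) ∣ width m := by
  rcases Nat.even_or_odd' m with ⟨a, rfl | rfl⟩
  · rw [width_two_mul, show (2 * a + 1) / 2 = a by omega]
    exact Dvd.intro_left 3 rfl
  · rw [width_two_mul_add_one, show (2 * a + 1 + 1) / 2 = a + 1 by omega, pow_succ]
    exact ⟨2, by ring⟩

/-- `w_n ≤ 2^{⌊n/2⌋+2}`. [cite: Graves2025, §1 (p. 2)] -/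
theorem width_le_two_pow (n : ℕ) : width n ≤ 2 ^ (n / 2 + 2) := by
  rcases Nat.even_or_odd' n with ⟨a, rfl | rfl⟩
  · rw [width_two_mul, show 2 * a / 2 = a by omega, pow_add]; norm_num; linarith [pow_pos (two_pos (α := ℤ)) a]
  · rw [width_two_mul_add_one, show (2 * a + 1) / 2 = a by omega, pow_add]; norm_num; linarith

/-- «If `2^l < w_n`, then `2^l ∣ w_m` for all `m > n`.» [cite: Graves2025, §1 (p. 2)] -/
theorem two_pow_dvd_width_of_lt {l n : ℕ} (h : (2 : ℤ) ^ l < width n) {m : ℕ} (hm : n < m) :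
    (2 : ℤ) ^ l ∣ width m := by
  have h1 := width_le_two_pow n
  have hl : l ≤ n / 2 + 1 := by
    by_contra hlt
    have : (2 : ℤ) ^ (n / 2 + 2) ≤ 2 ^ l := pow_le_pow_right₀ (by norm_num) (by omega)
    linarith
  exact (pow_dvd_pow 2 (show l ≤ (m + 1) / 2 by omega)).trans (two_pow_dvd_width m)

/-- If `3·2^v ≤ w_n` then `v ≤ ⌊n/2⌋`, so that `2^v ∣ w_m` for every `m ≥ n − 1`. [cite: Graves2025, §5.1 (p. 5)] -/
theorem le_half_of_three_mul_two_pow_le_width {v n : ℕ} (h : 3 * (2 : ℤ) ^ v ≤ width n) : v ≤ n / 2 := by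
  by_contra hlt
  have h1 := width_le_two_pow n
  have : (2 : ℤ) ^ (n / 2 + 1) ≤ 2 ^ v := pow_le_pow_right₀ (by norm_num) (by omega)
  rw [pow_succ] at this
  rw [pow_add] at h1
  linarith [pow_pos (two_pos (α := ℤ)) (n / 2)]

/-! ## §4 Theorem 1.1 / Corollary 1.3: `φ_{ℤ[i]}` through `ℓ∞`, `ℓ1`, `v₂` -/

/-- Theorem 2.5 of [Graves2023] in the language of `ℓ∞`, `ℓ1`, `v₂`: for `z ≠ 0`,
`z ∈ B_n ↔ ℓ∞(z) ≤ w_n − 2^{v₂(z)+1} ∧ ℓ1(z) ≤ w_{n+1} − 3·2^{v₂(z)}`. [cite: Graves2025, Thm. 1.1 (p. 2)] -/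
theorem mem_digitSet_iff_supNorm_le {n : ℕ} {z : ℤ√(-1)} (hz : z ≠ 0) :
    z ∈ digitSet n ↔ supNorm z ≤ width n - 2 ^ (twoVal z + 1) ∧ oneNorm z ≤ width (n + 1) - 3 * 2 ^ twoVal z := by
  rw [mem_digitSet_iff_of_exact hz (pow_twoVal_dvd z) (not_pow_twoVal_succ_dvd hz), Int.natCast_natAbs,
    Int.natCast_natAbs, supNorm, oneNorm, max_le_iff, and_assoc]

/-- **Corollary 1.3 (first sentence)**: «if `ℓ∞(z) ≤ w_n − 2^{v₂(z)+1}` and `ℓ1(z) ≤ w_{n+1} − 3·2^{v₂(z)}`,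
then `φ_{ℤ[i]}(z) ≤ n`» — here: `z ∈ B_n` (the text's `2^{v₂(x)}` is a misprint for `2^{v₂(z)}`).
[cite: Graves2025, Cor. 1.3 (p. 2)] -/
theorem mem_digitSet_of_supNorm_le {n : ℕ} {z : ℤ√(-1)} (h1 : supNorm z ≤ width n - 2 ^ (twoVal z + 1))
    (h2 : oneNorm z ≤ width (n + 1) - 3 * 2 ^ twoVal z) : z ∈ digitSet n := by
  by_cases hz : z = 0
  · rw [hz]; exact zero_mem_digitSet n
  exact (mem_digitSet_iff_supNorm_le hz).mpr ⟨h1, h2⟩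

/-- **Corollary 1.3 (second sentence)**: «`φ_{ℤ[i]}(z) > n − 1` iff either `ℓ∞(z) > w_{n−1} − 2^{v₂(z)+1}` or
`ℓ1(z) > w_n − 3·2^{v₂(z)}`» — here with `n − 1` renamed `n`: `z ∉ B_n ↔ …`. [cite: Graves2025, Cor. 1.3 (p. 2)] -/
theorem not_mem_digitSet_iff_lt {n : ℕ} {z : ℤ√(-1)} (hz : z ≠ 0) :
    z ∉ digitSet n ↔ width n - 2 ^ (twoVal z + 1) < supNorm z ∨ width (n + 1) - 3 * 2 ^ twoVal z < oneNorm z := by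
  rw [mem_digitSet_iff_supNorm_le hz]; omega

/-- `v₂(z) ≤ ⌊n/2⌋` for a non-zero `z ∈ B_n` (since `3·2^{v₂(z)} ≤ 2^{v₂(z)} + 2^{v₂(z)+1} ≤ w_n`); in particular
`2^{v₂(z)}` divides `w_{n−1}, w_n, w_{n+1}, …`. [cite: Graves2025, §5.1 (p. 5)] -/
theorem twoVal_le_half_of_mem_digitSet {n : ℕ} {z : ℤ√(-1)} (hz : z ≠ 0) (h : z ∈ digitSet n) :
    twoVal z ≤ n / 2 := by
  obtain ⟨h1, -⟩ := (mem_digitSet_iff_supNorm_le hz).mp h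
  apply le_half_of_three_mul_two_pow_le_width
  have hP : (2 : ℤ) ^ twoVal z ≤ supNorm z := by
    have hne : ¬(z.re = 0 ∧ z.im = 0) := fun h' ↦ hz (Zsqrtd.ext h'.1 h'.2)
    obtain ⟨hd1, hd2⟩ := pow_twoVal_dvd z
    have hP0 : (0 : ℤ) < 2 ^ twoVal z := pow_pos two_pos _
    rcases (show z.re ≠ 0 ∨ z.im ≠ 0 by tauto) with h0 | h0
    · exact (Int.le_of_dvd (abs_pos.mpr h0) ((dvd_abs _ _).mpr hd1)).trans (abs_re_le_supNorm z)
    · exact (Int.le_of_dvd (abs_pos.mpr h0) ((dvd_abs _ _).mpr hd2)).trans (abs_im_le_supNorm z)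
  rw [pow_succ] at h1
  linarith

/-- **Corollary 1.3 (last sentence)**: «if `φ_{ℤ[i]}(z) ≤ n`, then `m(z) ≤ w_{n−1} − 2^{v₂(z)+1}`» — here with
`n − 1` renamed `n`: `z ∈ B_{n+1} ⇒ m(z) ≤ w_n − 2^{v₂(z)+1}`. [cite: Graves2025, Cor. 1.3 (p. 2)] -/
theorem minAbs_le_of_mem_digitSet_succ {n : ℕ} {z : ℤ√(-1)} (h : z ∈ digitSet (n + 1)) :
    minAbs z ≤ width n - 2 ^ (twoVal z + 1) := by
  by_cases hz : z = 0
  · subst hz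
    simp only [minAbs, Zsqrtd.re_zero, Zsqrtd.im_zero, abs_zero, min_self, twoVal, Int.gcd_zero_left,
      Int.natAbs_zero, padicValNat_zero_right, zero_add, pow_one]
    linarith [three_le_width n]
  obtain ⟨-, h2⟩ := (mem_digitSet_iff_supNorm_le hz).mp h
  have hv := twoVal_le_half_of_mem_digitSet hz h
  set P : ℤ := 2 ^ twoVal z with hP
  have hP0 : 0 < P := pow_pos two_pos _
  -- `2^{v₂(z)} ∣ w_n` and `2^{v₂(z)} ∣ m(z)`
  have hdw : P ∣ width n := (pow_dvd_pow 2 (show twoVal z ≤ (n + 1) / 2 by omega)).trans (two_pow_dvd_width n)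
  have hdm : P ∣ minAbs z := by
    unfold minAbs
    rcases min_cases |z.re| |z.im| with ⟨h', -⟩ | ⟨h', -⟩ <;> rw [h', dvd_abs]
    · exact (pow_twoVal_dvd z).1
    · exact (pow_twoVal_dvd z).2
  rw [width_add_two] at h2
  have h3 := two_mul_minAbs_le_oneNorm z
  -- `m(z) ≤ w_n − (3/2)P < w_n − P`, and both sides are multiples of `P`
  have hlt : 0 < (width n - P) - minAbs z := by linarith
  have hle := Int.le_of_dvd hlt (dvd_sub (dvd_sub hdw dvd_rfl) hdm)
  rw [pow_succ]
  linarith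

/-- `φ_{ℤ[i]}` through `B_n`: for `z ≠ 0`, `φ(z) ≤ n ↔ ℓ∞(z) ≤ w_n − 2^{v₂(z)+1} ∧ ℓ1(z) ≤ w_{n+1} − 3·2^{v₂(z)}`
(Theorem 1.1 / Corollary 1.3 for Motzkin's minimal Euclidean function `motzkinNorm`). [cite: Graves2025, Thm. 1.1 (p. 2)] -/
theorem motzkinNorm_le_iff_supNorm_le {z : ℤ√(-1)} (hz : z ≠ 0) (n : ℕ) :
    motzkinNorm forall_exists_not_mem_motzkinSet z ≤ n ↔
      supNorm z ≤ width n - 2 ^ (twoVal z + 1) ∧ oneNorm z ≤ width (n + 1) - 3 * 2 ^ twoVal z := by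
  rw [motzkinNorm_le_iff_mem_digitSet hz, mem_digitSet_iff_supNorm_le hz]


/-! ## §5 The cone `−x < y ≤ x`, the units `u_z` (Definition 1.2) and the sign `s(r)` (Definition 1.4) -/

/-- `z = x+yi` lies in the NORMAL CONE if `−x < y ≤ x`: then `Re z = ℓ∞(z)`, `|Im z| = m(z)`, and in the tie case
`|x| = |y|` one has `z = ℓ∞(z)(1+i)`.  This is the position into which Definition 1.2 rotates `z` by the unit
`u_z`. [cite: Graves2025, Def. 1.2 (p. 2)] -/
def InNormalCone (z : ℤ√(-1)) : Prop := -z.re < z.im ∧ z.im ≤ z.re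

/-- Unfolding the cone. [cite: Graves2025, Def. 1.2 (p. 2)] -/
theorem inNormalCone_iff (z : ℤ√(-1)) : InNormalCone z ↔ -z.re < z.im ∧ z.im ≤ z.re := Iff.rfl

/-- Definition 1.2's dichotomy: `z` is in the normal cone iff either `Re z = ℓ∞(z) > m(z) = |Im z|`
(`ℓ∞(z) ≠ m(z)`) or `z = ℓ∞(z)(1+i)` with `ℓ∞(z) > 0` (`ℓ∞(z) = m(z)`). [cite: Graves2025, Def. 1.2 (p. 2)] -/
theorem inNormalCone_iff_abs (z : ℤ√(-1)) : InNormalCone z ↔ |z.im| < z.re ∨ (0 < z.re ∧ z.im = z.re) := by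
  unfold InNormalCone
  rcases abs_cases z.im with ⟨h, _⟩ | ⟨h, _⟩ <;> omega

/-- In the normal cone `Re z > 0`. [cite: Graves2025, Def. 1.2 (p. 2)] -/
theorem InNormalCone.re_pos {z : ℤ√(-1)} (h : InNormalCone z) : 0 < z.re := by
  unfold InNormalCone at h; omega

/-- In the normal cone `z ≠ 0`. [cite: Graves2025, Def. 1.2 (p. 2)] -/
theorem InNormalCone.ne_zero {z : ℤ√(-1)} (h : InNormalCone z) : z ≠ 0 := by
  rintro rfl; exact absurd h.re_pos (by simp)

/-- In the normal cone `ℓ∞(z) = Re z`. [cite: Graves2025, Def. 1.2 (p. 2)] -/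
theorem InNormalCone.supNorm_eq {z : ℤ√(-1)} (h : InNormalCone z) : supNorm z = z.re := by
  unfold InNormalCone at h
  unfold supNorm
  rcases abs_cases z.re with ⟨h1, _⟩ | ⟨h1, _⟩ <;> rcases abs_cases z.im with ⟨h2, _⟩ | ⟨h2, _⟩ <;> omega

/-- In the normal cone `m(z) = |Im z|`. [cite: Graves2025, Def. 1.2 (p. 2)] -/
theorem InNormalCone.minAbs_eq {z : ℤ√(-1)} (h : InNormalCone z) : minAbs z = |z.im| := by
  unfold InNormalCone at h
  unfold minAbs
  rcases abs_cases z.re with ⟨h1, _⟩ | ⟨h1, _⟩ <;> rcases abs_cases z.im with ⟨h2, _⟩ | ⟨h2, _⟩ <;> omega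

/-- In the normal cone `ℓ1(z) = Re z + |Im z|`. [cite: Graves2025, Def. 1.2 (p. 2)] -/
theorem InNormalCone.oneNorm_eq {z : ℤ√(-1)} (h : InNormalCone z) : oneNorm z = z.re + |z.im| := by
  rw [oneNorm_eq_supNorm_add_minAbs, h.supNorm_eq, h.minAbs_eq]

/-- The cone is stable under scaling by a positive integer. [cite: Graves2025, Def. 1.2 (p. 2)] -/
theorem inNormalCone_intCast_mul_iff {P : ℤ} (hP : 0 < P) (z : ℤ√(-1)) :
    InNormalCone ((P : ℤ√(-1)) * z) ↔ InNormalCone z := by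
  unfold InNormalCone
  rw [Zsqrtd.re_smul, Zsqrtd.im_smul]
  constructor
  · rintro ⟨h1, h2⟩
    constructor
    · by_contra h; rw [not_lt] at h; nlinarith
    · by_contra h; rw [not_le] at h; nlinarith
  · rintro ⟨h1, h2⟩
    constructor <;> nlinarith

/-- **`u_z`** (Definition 1.2): the unit rotating `z ≠ 0` into the normal cone — «if `ℓ∞(z) ≠ m(z)`, the unique unit
`u_z` such that `Re(u_z z) = ℓ∞(z)`; if `ℓ∞(z) = m(z)`, the unique unit with `u_z z = ℓ∞(z)(1+i)`» (e.g.
`u_{−1+2i} = −i`, `u_{1−i} = i`).  The four branches test `z`, `iz`, `−z`, `−iz` for the cone. [cite: Graves2025, Def. 1.2 (p. 2)] -/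
def normalUnit (z : ℤ√(-1)) : ℤ√(-1) :=
  if -z.re < z.im ∧ z.im ≤ z.re then 1
  else if z.im < z.re ∧ z.re ≤ -z.im then ⟨0, 1⟩
  else if z.re < -z.im ∧ z.re ≤ z.im then -1
  else ⟨0, -1⟩

/-- `u_z ∈ {1, i, −1, −i}`. [cite: Graves2025, Def. 1.2 (p. 2)] -/
theorem normalUnit_mem (z : ℤ√(-1)) :
    normalUnit z = 1 ∨ normalUnit z = ⟨0, 1⟩ ∨ normalUnit z = -1 ∨ normalUnit z = ⟨0, -1⟩ := by
  unfold normalUnit; split_ifs <;> simp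

/-- `u_z` is a unit. [cite: Graves2025, Def. 1.2 (p. 2)] -/
theorem isUnit_normalUnit (z : ℤ√(-1)) : IsUnit (normalUnit z) := by
  rcases normalUnit_mem z with h | h | h | h <;> rw [h]
  · exact isUnit_one
  · exact isUnit_i
  · exact isUnit_one.neg
  · exact ZSqrt.isUnit_iff_neg_one.mpr (by simp)

/-- `u_z · conj(u_z) = 1`. [cite: Graves2025, Def. 1.2 (p. 2)] -/
theorem normalUnit_mul_star (z : ℤ√(-1)) : normalUnit z * star (normalUnit z) = 1 := by
  rcases normalUnit_mem z with h | h | h | h <;> rw [h] <;> decide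

/-- `u_z z` lies in the normal cone (`z ≠ 0`). [cite: Graves2025, Def. 1.2 (p. 2)] -/
theorem inNormalCone_normalUnit_mul {z : ℤ√(-1)} (hz : z ≠ 0) : InNormalCone (normalUnit z * z) := by
  have h : ¬(z.re = 0 ∧ z.im = 0) := fun h ↦ hz (Zsqrtd.ext h.1 h.2)
  unfold normalUnit InNormalCone
  split_ifs with h1 h2 h3 <;> simp only [one_mul, neg_mul, Zsqrtd.re_neg, Zsqrtd.im_neg, Zsqrtd.re_mul,
    Zsqrtd.im_mul, neg_neg] <;> omega

/-- Uniqueness in Definition 1.2: the only unit rotating `z` into the normal cone is `u_z`. [cite: Graves2025, Def. 1.2 (p. 2)] -/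
theorem normalUnit_eq_of_inNormalCone {u z : ℤ√(-1)} (hu : IsUnit u) (h : InNormalCone (u * z)) :
    normalUnit z = u := by
  unfold InNormalCone at h
  unfold normalUnit
  rcases ZSqrt.isUnit_iff_neg_one.mp hu with rfl | rfl | rfl | rfl <;>
    simp only [one_mul, neg_mul, Zsqrtd.re_neg, Zsqrtd.im_neg, Zsqrtd.re_mul, Zsqrtd.im_mul] at h <;>
    split_ifs <;> first | rfl | (exfalso; omega)

/-- `u_z = 1` for `z` already in the cone. [cite: Graves2025, Def. 1.2 (p. 2)] -/
theorem InNormalCone.normalUnit_eq {z : ℤ√(-1)} (h : InNormalCone z) : normalUnit z = 1 :=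
  normalUnit_eq_of_inNormalCone isUnit_one (by rwa [one_mul])

/-- The printed examples: `u_{−1+2i} = −i` and `u_{1−i} = i`. [cite: Graves2025, Def. 1.2 (p. 2)] -/
theorem normalUnit_examples : normalUnit ⟨-1, 2⟩ = ⟨0, -1⟩ ∧ normalUnit ⟨1, -1⟩ = ⟨0, 1⟩ := by
  constructor <;> decide

/-- `u_{Pz} = u_z` for a positive integer `P`. [cite: Graves2025, Def. 1.2 (p. 2)] -/
theorem normalUnit_intCast_mul {P : ℤ} (hP : 0 < P) {z : ℤ√(-1)} (hz : z ≠ 0) :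
    normalUnit ((P : ℤ√(-1)) * z) = normalUnit z := by
  apply normalUnit_eq_of_inNormalCone (isUnit_normalUnit z)
  rw [mul_left_comm, inNormalCone_intCast_mul_iff hP]
  exact inNormalCone_normalUnit_mul hz

/-- **`s(r)`** `= sgn(Im(u_r r))` (Definition 1.4). [cite: Graves2025, Def. 1.4 (p. 2)] -/
def imSign (r : ℤ√(-1)) : ℤ := Int.sign (normalUnit r * r).im

/-- Unfolding `s(r)`. [cite: Graves2025, Def. 1.4 (p. 2)] -/
theorem imSign_def (r : ℤ√(-1)) : imSign r = Int.sign (normalUnit r * r).im := rfl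

/-- For `r` in the cone, `s(r) = sgn(Im r)`. [cite: Graves2025, Def. 1.4 (p. 2)] -/
theorem InNormalCone.imSign_eq {r : ℤ√(-1)} (h : InNormalCone r) : imSign r = Int.sign r.im := by
  rw [imSign, h.normalUnit_eq, one_mul]

/-! ## §6 Gauss quotients and remainders (§3): Lemma 3.1 and Lemma 3.2 -/

/-- `r` is a GAUSS REMAINDER modulo `b`: `r/b = f₀ + f₁ i` with `|f₀|, |f₁| ≤ 1/2`, i.e.
`2|Re(r b̄)| ≤ N(b)` and `2|Im(r b̄)| ≤ N(b)` (§3: `a = (q₀+q₁i) b + (f₀+f₁i) b` with `q₀ = ⌊(xc−yd)/N(b)⌉`, …;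
any nearest-integer convention gives such an `r = a − qb`, and conversely). [cite: Graves2025, §3 (p. 3)] -/
def IsGaussRemainder (b r : ℤ√(-1)) : Prop :=
  2 * |(r * star b).re| ≤ b.norm ∧ 2 * |(r * star b).im| ≤ b.norm

/-- Unfolding. [cite: Graves2025, §3 (p. 3)] -/
theorem isGaussRemainder_iff (b r : ℤ√(-1)) :
    IsGaussRemainder b r ↔ 2 * |(r * star b).re| ≤ b.norm ∧ 2 * |(r * star b).im| ≤ b.norm := Iff.rfl

/-- Coordinates of `r b̄`: `Re = gx + hy`, `Im = hx − gy` for `r = g+hi`, `b = x+yi`. [cite: Graves2025, §3 (p. 3)] -/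
theorem re_im_mul_star (r b : ℤ√(-1)) :
    (r * star b).re = r.re * b.re + r.im * b.im ∧ (r * star b).im = r.im * b.re - r.re * b.im := by
  simp only [Zsqrtd.re_mul, Zsqrtd.im_mul, Zsqrtd.re_star, Zsqrtd.im_star]
  constructor <;> ring

/-- **Gauss's division algorithm** (§3): Mathlib's Euclidean division of `ℤ[i]` rounds `a b̄ / N(b)` to a nearest
Gaussian integer, so `a % b` is a Gauss remainder modulo `b` (and `a = (a / b) b + a % b`). [cite: Graves2025, §3 (p. 3)] -/
theorem isGaussRemainder_mod (a b : ℤ√(-1)) : IsGaussRemainder b (a % b) := by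
  by_cases hb : b = 0
  · subst hb
    simp [IsGaussRemainder, Zsqrtd.norm_def]
  have hN0 : 0 < b.norm := lt_of_le_of_ne (Zsqrtd.norm_nonneg (by norm_num) b)
    (fun h ↦ hb ((Zsqrtd.norm_eq_zero_iff (by norm_num) b).mp h.symm))
  have key : ∀ t : ℤ, 2 * |t - b.norm * round ((t : ℚ) / b.norm)| ≤ b.norm := by
    intro t
    have h := abs_sub_round ((t : ℚ) / b.norm)
    have hNq : (0 : ℚ) < b.norm := by exact_mod_cast hN0
    have h2 : |((t : ℚ) - b.norm * round ((t : ℚ) / b.norm))| ≤ b.norm / 2 := by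
      rw [show (t : ℚ) - b.norm * round ((t : ℚ) / b.norm) = b.norm * ((t : ℚ) / b.norm - round ((t : ℚ) / b.norm))
        by field_simp, abs_mul, abs_of_pos hNq]
      calc (b.norm : ℚ) * |(t : ℚ) / b.norm - round ((t : ℚ) / b.norm)| ≤ b.norm * (1 / 2) :=
            mul_le_mul_of_nonneg_left h hNq.le
        _ = b.norm / 2 := by ring
    have h3 : (2 : ℚ) * |((t : ℚ) - b.norm * round ((t : ℚ) / b.norm))| ≤ b.norm := by linarith
    exact_mod_cast h3
  have hmod : a % b * star b = a * star b - (b.norm : ℤ√(-1)) * (a / b) := by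
    rw [GaussianInt.mod_def, sub_mul, mul_right_comm, Zsqrtd.norm_eq_mul_conj]
  constructor
  · rw [hmod, Zsqrtd.re_sub, Zsqrtd.re_smul, GaussianInt.div_def]
    exact key _
  · rw [hmod, Zsqrtd.im_sub, Zsqrtd.im_smul, GaussianInt.div_def]
    exact key _

/-- Mathlib's division identity `a = (a / b) b + (a % b)` (the Gauss quotient and remainder). [cite: Graves2025, §3 (p. 3)] -/
theorem div_mul_add_mod_eq (a b : ℤ√(-1)) : a / b * b + a % b = a := by
  rw [mul_comm]; exact EuclideanDomain.div_add_mod a b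

/-- A Gauss remainder modulo a unit is `0`. [cite: Graves2025, §3 (p. 3)] -/
theorem IsGaussRemainder.eq_zero_of_isUnit {b r : ℤ√(-1)} (h : IsGaussRemainder b r) (hb : IsUnit b) : r = 0 := by
  have hN : b.norm = 1 := (Zsqrtd.norm_eq_one_iff' (by norm_num) b).mpr hb
  obtain ⟨h1, h2⟩ := h
  rw [hN] at h1 h2
  have h0 : r * star b = 0 := by
    apply Zsqrtd.ext <;> simp only [Zsqrtd.re_zero, Zsqrtd.im_zero]
    · rcases abs_cases (r * star b).re with ⟨h', _⟩ | ⟨h', _⟩ <;> omega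
    · rcases abs_cases (r * star b).im with ⟨h', _⟩ | ⟨h', _⟩ <;> omega
  have hsb : star b ≠ 0 := by
    intro h'
    have : b = 0 := by simpa using congrArg star h'
    exact hb.ne_zero this
  exact (mul_eq_zero.mp h0).resolve_right hsb

/-- **Lemma 3.1**: «The pair `a` and `b` have Gauss quotient `q` and Gauss remainder `r` if and only if `za` and
`zb` have Gauss quotient `q` and Gauss remainder `zr`» — the remainder condition scales with `z ≠ 0` (the quotient
identity `za = q(zb) + zr ↔ a = qb + r` is `mul_left_cancel₀`). [cite: Graves2025, Lemma 3.1 (p. 3)] -/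
theorem isGaussRemainder_mul_iff {z : ℤ√(-1)} (hz : z ≠ 0) (b r : ℤ√(-1)) :
    IsGaussRemainder (z * b) (z * r) ↔ IsGaussRemainder b r := by
  have hN0 : 0 < z.norm := lt_of_le_of_ne (Zsqrtd.norm_nonneg (by norm_num) z)
    (fun h ↦ hz ((Zsqrtd.norm_eq_zero_iff (by norm_num) z).mp h.symm))
  have hprod : z * r * star (z * b) = (z.norm : ℤ√(-1)) * (r * star b) := by
    rw [star_mul, Zsqrtd.norm_eq_mul_conj]; ring
  unfold IsGaussRemainder
  rw [hprod, Zsqrtd.re_smul, Zsqrtd.im_smul, Zsqrtd.norm_mul, abs_mul, abs_mul, abs_of_pos hN0]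
  constructor
  · rintro ⟨h1, h2⟩
    exact ⟨le_of_mul_le_mul_left (by linarith) hN0, le_of_mul_le_mul_left (by linarith) hN0⟩
  · rintro ⟨h1, h2⟩
    exact ⟨by nlinarith, by nlinarith⟩

/-- Lemma 3.1, quotient part: `za = q(zb) + zr ↔ a = qb + r` for `z ≠ 0`. [cite: Graves2025, Lemma 3.1 (p. 3)] -/
theorem mul_eq_mul_add_mul_iff {z : ℤ√(-1)} (hz : z ≠ 0) (a b q r : ℤ√(-1)) :
    z * a = q * (z * b) + z * r ↔ a = q * b + r := by
  rw [show q * (z * b) + z * r = z * (q * b + r) by ring]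
  exact ⟨mul_left_cancel₀ hz, fun h ↦ by rw [h]⟩

/-- Gauss remainders are preserved by unit changes `b ↦ ub`, `r ↦ wr`. [cite: Graves2025, §2 (p. 3)] -/
theorem IsGaussRemainder.unit_mul {b r u w : ℤ√(-1)} (h : IsGaussRemainder b r) (hu : IsUnit u) (hw : IsUnit w) :
    IsGaussRemainder (u * b) (w * r) := by
  have hN : (u * b).norm = b.norm := by
    rw [Zsqrtd.norm_mul, (Zsqrtd.norm_eq_one_iff' (by norm_num) u).mpr hu, one_mul]
  have hprod : w * r * star (u * b) = (w * star u) * (r * star b) := by rw [star_mul]; ring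
  have hwu : IsUnit (w * star u) := hw.mul hu.star
  unfold IsGaussRemainder at h ⊢
  rw [hN, hprod]
  rcases abs_re_im_unit_mul hwu (r * star b) with ⟨h1, h2⟩ | ⟨h1, h2⟩ <;> rw [h1, h2]
  · exact h
  · exact ⟨h.2, h.1⟩

/-- The key estimate behind Lemma 3.2: `2|A|, 2|B| ≤ N ⇒ 2(As + Bt) ≤ N(|s| + |t|)`. [cite: Graves2025, Lemma 3.2 (p. 4)] -/
theorem two_mul_le_of_abs_le {A B N : ℤ} (hA : 2 * |A| ≤ N) (hB : 2 * |B| ≤ N) (s t : ℤ) :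
    2 * (A * s + B * t) ≤ N * (|s| + |t|) := by
  have h1 : A * s ≤ |A| * |s| := by rw [← abs_mul]; exact le_abs_self _
  have h2 : B * t ≤ |B| * |t| := by rw [← abs_mul]; exact le_abs_self _
  have h3 : 2 * |A| * |s| ≤ N * |s| := mul_le_mul_of_nonneg_right hA (abs_nonneg s)
  have h4 : 2 * |B| * |t| ≤ N * |t| := mul_le_mul_of_nonneg_right hB (abs_nonneg t)
  linarith

/-- Strict form: if moreover `2|A| < N`, `2|B| < N` and `(s, t) ≠ (0, 0)`, the estimate is strict.
[cite: Graves2025, Lemma 3.2 (p. 4)] -/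
theorem two_mul_lt_of_abs_lt {A B N : ℤ} (hA : 2 * |A| < N) (hB : 2 * |B| < N) {s t : ℤ} (hst : ¬(s = 0 ∧ t = 0)) :
    2 * (A * s + B * t) < N * (|s| + |t|) := by
  have h1 : A * s ≤ |A| * |s| := by rw [← abs_mul]; exact le_abs_self _
  have h2 : B * t ≤ |B| * |t| := by rw [← abs_mul]; exact le_abs_self _
  have h3 : 2 * |A| * |s| ≤ N * |s| := mul_le_mul_of_nonneg_right hA.le (abs_nonneg s)
  have h4 : 2 * |B| * |t| ≤ N * |t| := mul_le_mul_of_nonneg_right hB.le (abs_nonneg t)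
  rcases (show s ≠ 0 ∨ t ≠ 0 by tauto) with h0 | h0
  · have h3' : 2 * |A| * |s| < N * |s| := mul_lt_mul_of_pos_right hA (abs_pos.mpr h0)
    linarith
  · have h4' : 2 * |B| * |t| < N * |t| := mul_lt_mul_of_pos_right hB (abs_pos.mpr h0)
    linarith

/-- `N(b) r = (r b̄) b` in coordinates: `N g = Ax − By`, `N h = Ay + Bx` (`A + Bi = r b̄`, `b = x+yi`, `r = g+hi`).
[cite: Graves2025, Lemma 3.2 (p. 4)] -/
theorem norm_mul_re_im (b r : ℤ√(-1)) :
    b.norm * r.re = (r * star b).re * b.re - (r * star b).im * b.im ∧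
      b.norm * r.im = (r * star b).re * b.im + (r * star b).im * b.re := by
  obtain ⟨h1, h2⟩ := re_im_mul_star r b
  rw [h1, h2, Zsqrtd.norm_def]
  constructor <;> ring

/-- `|x + y| + |x − y| = 2 max(|x|, |y|)`. [cite: Graves2025, Lemma 3.2 (p. 4)] -/
theorem abs_add_add_abs_sub (x y : ℤ) : |x + y| + |x - y| = 2 * max |x| |y| := by
  rcases abs_cases (x + y) with ⟨h1, _⟩ | ⟨h1, _⟩ <;> rcases abs_cases (x - y) with ⟨h2, _⟩ | ⟨h2, _⟩ <;>
    rcases abs_cases x with ⟨h3, _⟩ | ⟨h3, _⟩ <;> rcases abs_cases y with ⟨h4, _⟩ | ⟨h4, _⟩ <;> omega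

/-- **Lemma 3.2** (the two inequalities): a Gauss remainder `r` modulo `b ≠ 0` satisfies `ℓ1(r) ≤ ℓ∞(b)` and
`ℓ∞(r) ≤ ℓ1(b)/2`.  (The printed rider «Equality occurs only if `r/b ∈ ±½{1, i, 1 ± i}`» is NOT formalised: it
fails as stated, e.g. `b = 3+3i`, `r = 1+2i` has `ℓ1(r) = 3 = ℓ∞(b)` with `r/b = 1/2 + i/6`, and `b = 4`,
`r = 2+i` has `ℓ∞(r) = 2 = ℓ1(b)/2` with `r/b = 1/2 + i/4`; the strict forms actually needed downstream are
`oneNorm_lt_supNorm_of_lt` / `IsGaussRemainder.two_mul_supNorm_lt` below and Lemma 4.1.)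
[cite: Graves2025, Lemma 3.2 (p. 4)] -/
theorem IsGaussRemainder.oneNorm_le {b r : ℤ√(-1)} (h : IsGaussRemainder b r) (hb : b ≠ 0) :
    oneNorm r ≤ supNorm b ∧ 2 * supNorm r ≤ oneNorm b := by
  obtain ⟨hA, hB⟩ := h
  set A := (r * star b).re
  set B := (r * star b).im
  set N := b.norm
  have hN0 : 0 < N := lt_of_le_of_ne (Zsqrtd.norm_nonneg (by norm_num) b)
    (fun h ↦ hb ((Zsqrtd.norm_eq_zero_iff (by norm_num) b).mp h.symm))
  obtain ⟨hg, hh⟩ := norm_mul_re_im b r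
  set x := b.re; set y := b.im; set g := r.re; set hh' := r.im
  have key := two_mul_le_of_abs_le hA hB
  constructor
  · -- `ℓ1(r) ≤ ℓ∞(b)`: `N(±g ± h) = A(±x ± y) + B(…) ≤ N max(|x|,|y|)`
    unfold oneNorm supNorm
    have hmax : N * (|x + y| + |x - y|) = 2 * (N * max |x| |y|) := by rw [abs_add_add_abs_sub x y]; ring
    have e1 : N * (g + r.im) * 2 = 2 * (A * (x + y) + B * (x - y)) := by rw [mul_add N, hg, hh]; ring
    have e2 : N * (g - r.im) * 2 = 2 * (A * (x - y) + B * (-(x + y))) := by rw [mul_sub N, hg, hh]; ring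
    have e3 : N * (-g + r.im) * 2 = 2 * (A * (-(x - y)) + B * (x + y)) := by
      rw [mul_add N, mul_neg, hg, hh]; ring
    have e4 : N * (-g - r.im) * 2 = 2 * (A * (-(x + y)) + B * (-(x - y))) := by
      rw [mul_sub N, mul_neg, hg, hh]; ring
    have k1 := key (x + y) (x - y)
    have k2 := key (x - y) (-(x + y))
    have k3 := key (-(x - y)) (x + y)
    have k4 := key (-(x + y)) (-(x - y))
    rw [abs_neg] at k2 k3 k4
    rw [abs_neg] at k4
    have l1 : g + r.im ≤ max |x| |y| := le_of_mul_le_mul_left (by linarith) hN0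
    have l2 : g - r.im ≤ max |x| |y| := le_of_mul_le_mul_left (by linarith) hN0
    have l3 : -g + r.im ≤ max |x| |y| := le_of_mul_le_mul_left (by linarith) hN0
    have l4 : -g - r.im ≤ max |x| |y| := le_of_mul_le_mul_left (by linarith) hN0
    rcases abs_cases g with ⟨h1, _⟩ | ⟨h1, _⟩ <;> rcases abs_cases r.im with ⟨h2, _⟩ | ⟨h2, _⟩ <;> linarith
  · -- `2ℓ∞(r) ≤ ℓ1(b)`: `2N|g| ≤ 2|A||x| + 2|B||y| ≤ N(|x|+|y|)`
    unfold oneNorm supNorm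
    have e1 : N * g * 2 = 2 * (A * x + B * (-y)) := by rw [hg]; ring
    have e2 : N * (-g) * 2 = 2 * (A * (-x) + B * y) := by rw [mul_neg, hg]; ring
    have e3 : N * r.im * 2 = 2 * (A * y + B * x) := by rw [hh]; ring
    have e4 : N * (-r.im) * 2 = 2 * (A * (-y) + B * (-x)) := by rw [mul_neg, hh]; ring
    have k1 := key x (-y)
    have k2 := key (-x) y
    have k3 := key y x
    have k4 := key (-y) (-x)
    rw [abs_neg] at k1 k2 k4
    rw [abs_neg] at k4
    have l1 : g * 2 ≤ |x| + |y| := le_of_mul_le_mul_left (by linarith) hN0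
    have l2 : -g * 2 ≤ |x| + |y| := le_of_mul_le_mul_left (by linarith) hN0
    have l3 : r.im * 2 ≤ |x| + |y| := le_of_mul_le_mul_left (by linarith) hN0
    have l4 : -r.im * 2 ≤ |x| + |y| := le_of_mul_le_mul_left (by linarith) hN0
    rcases abs_cases g with ⟨h1, _⟩ | ⟨h1, _⟩ <;> rcases abs_cases r.im with ⟨h2, _⟩ | ⟨h2, _⟩ <;>
      rcases max_cases |g| |r.im| with ⟨h3, _⟩ | ⟨h3, _⟩ <;> linarith

/-- Lemma 3.2 with the widths: if moreover `b ∈ B_n` then `ℓ1(r) ≤ ℓ∞(b) < w_n`. [cite: Graves2025, Lemma 3.2 (p. 4)] -/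
theorem IsGaussRemainder.oneNorm_lt_width {b r : ℤ√(-1)} {n : ℕ} (h : IsGaussRemainder b r) (hb : b ≠ 0)
    (hbn : b ∈ digitSet n) : oneNorm r ≤ supNorm b ∧ supNorm b < width n := by
  refine ⟨(h.oneNorm_le hb).1, ?_⟩
  obtain ⟨h1, -⟩ := (mem_digitSet_iff_supNorm_le hb).mp hbn
  have : (0 : ℤ) < 2 ^ (twoVal b + 1) := pow_pos two_pos _
  linarith

/-- Lemma 3.2 with the widths: if `b ∈ B_{n+1}` then `2ℓ∞(r) ≤ ℓ1(b) < 2 w_n`. [cite: Graves2025, Lemma 3.2 (p. 4)] -/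
theorem IsGaussRemainder.two_mul_supNorm_lt_width {b r : ℤ√(-1)} {n : ℕ} (h : IsGaussRemainder b r) (hb : b ≠ 0)
    (hbn : b ∈ digitSet (n + 1)) : 2 * supNorm r ≤ oneNorm b ∧ oneNorm b < 2 * width n := by
  refine ⟨(h.oneNorm_le hb).2, ?_⟩
  obtain ⟨-, h2⟩ := (mem_digitSet_iff_supNorm_le hb).mp hbn
  have : (0 : ℤ) < 2 ^ twoVal b := pow_pos two_pos _
  rw [width_add_two] at h2
  linarith

/-- Strict Lemma 3.2: if `r/b` lies in the OPEN square (`2|Re(r b̄)| < N(b)`, `2|Im(r b̄)| < N(b)`) then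
`ℓ1(r) < ℓ∞(b)` and `2ℓ∞(r) < ℓ1(b)`. [cite: Graves2025, Lemma 3.2 (p. 4)] -/
theorem oneNorm_lt_supNorm_of_lt {b r : ℤ√(-1)} (hb : b ≠ 0) (hA : 2 * |(r * star b).re| < b.norm)
    (hB : 2 * |(r * star b).im| < b.norm) : oneNorm r < supNorm b ∧ 2 * supNorm r < oneNorm b := by
  set A := (r * star b).re
  set B := (r * star b).im
  set N := b.norm
  have hxy : ¬(b.re = 0 ∧ b.im = 0) := fun h' ↦ hb (Zsqrtd.ext h'.1 h'.2)
  have hN0 : 0 < N := lt_of_le_of_ne (Zsqrtd.norm_nonneg (by norm_num) b)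
    (fun h ↦ hb ((Zsqrtd.norm_eq_zero_iff (by norm_num) b).mp h.symm))
  obtain ⟨hg, hh⟩ := norm_mul_re_im b r
  set x := b.re; set y := b.im; set g := r.re
  have key : ∀ s t : ℤ, ¬(s = 0 ∧ t = 0) → 2 * (A * s + B * t) < N * (|s| + |t|) :=
    fun s t hst ↦ two_mul_lt_of_abs_lt hA hB hst
  constructor
  · unfold oneNorm supNorm
    have hmax : N * (|x + y| + |x - y|) = 2 * (N * max |x| |y|) := by rw [abs_add_add_abs_sub x y]; ring
    have e1 : N * (g + r.im) * 2 = 2 * (A * (x + y) + B * (x - y)) := by rw [mul_add N, hg, hh]; ring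
    have e2 : N * (g - r.im) * 2 = 2 * (A * (x - y) + B * (-(x + y))) := by rw [mul_sub N, hg, hh]; ring
    have e3 : N * (-g + r.im) * 2 = 2 * (A * (-(x - y)) + B * (x + y)) := by
      rw [mul_add N, mul_neg, hg, hh]; ring
    have e4 : N * (-g - r.im) * 2 = 2 * (A * (-(x + y)) + B * (-(x - y))) := by
      rw [mul_sub N, mul_neg, hg, hh]; ring
    have k1 := key (x + y) (x - y) (by omega)
    have k2 := key (x - y) (-(x + y)) (by omega)
    have k3 := key (-(x - y)) (x + y) (by omega)
    have k4 := key (-(x + y)) (-(x - y)) (by omega)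
    rw [abs_neg] at k2 k3 k4
    rw [abs_neg] at k4
    have l1 : g + r.im < max |x| |y| := lt_of_mul_lt_mul_left (by linarith) hN0.le
    have l2 : g - r.im < max |x| |y| := lt_of_mul_lt_mul_left (by linarith) hN0.le
    have l3 : -g + r.im < max |x| |y| := lt_of_mul_lt_mul_left (by linarith) hN0.le
    have l4 : -g - r.im < max |x| |y| := lt_of_mul_lt_mul_left (by linarith) hN0.le
    rcases abs_cases g with ⟨h1, _⟩ | ⟨h1, _⟩ <;> rcases abs_cases r.im with ⟨h2, _⟩ | ⟨h2, _⟩ <;> linarith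
  · unfold oneNorm supNorm
    have e1 : N * g * 2 = 2 * (A * x + B * (-y)) := by rw [hg]; ring
    have e2 : N * (-g) * 2 = 2 * (A * (-x) + B * y) := by rw [mul_neg, hg]; ring
    have e3 : N * r.im * 2 = 2 * (A * y + B * x) := by rw [hh]; ring
    have e4 : N * (-r.im) * 2 = 2 * (A * (-y) + B * (-x)) := by rw [mul_neg, hh]; ring
    have k1 := key x (-y) (by omega)
    have k2 := key (-x) y (by omega)
    have k3 := key y x (by omega)
    have k4 := key (-y) (-x) (by omega)
    rw [abs_neg] at k1 k2 k4
    rw [abs_neg] at k4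
    have l1 : g * 2 < |x| + |y| := lt_of_mul_lt_mul_left (by linarith) hN0.le
    have l2 : -g * 2 < |x| + |y| := lt_of_mul_lt_mul_left (by linarith) hN0.le
    have l3 : r.im * 2 < |x| + |y| := lt_of_mul_lt_mul_left (by linarith) hN0.le
    have l4 : -r.im * 2 < |x| + |y| := lt_of_mul_lt_mul_left (by linarith) hN0.le
    rcases abs_cases g with ⟨h1, _⟩ | ⟨h1, _⟩ <;> rcases abs_cases r.im with ⟨h2, _⟩ | ⟨h2, _⟩ <;>
      rcases max_cases |g| |r.im| with ⟨h3, _⟩ | ⟨h3, _⟩ <;> linarith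

/-- If `N(b)` is odd there are no ties, so a Gauss remainder satisfies the strict inequalities of Lemma 3.2.
[cite: Graves2025, Lemma 3.2 (p. 4)] -/
theorem IsGaussRemainder.oneNorm_lt_of_odd_norm {b r : ℤ√(-1)} (h : IsGaussRemainder b r) (hodd : ¬(2 ∣ b.norm)) :
    oneNorm r < supNorm b ∧ 2 * supNorm r < oneNorm b := by
  have hb : b ≠ 0 := by rintro rfl; exact hodd (by simp [Zsqrtd.norm_def])
  obtain ⟨h1, h2⟩ := h
  exact oneNorm_lt_supNorm_of_lt hb (lt_of_le_of_ne h1 fun h' ↦ hodd (Dvd.intro _ h'))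
    (lt_of_le_of_ne h2 fun h' ↦ hodd (Dvd.intro _ h'))


/-! ## §7 Lemma 4.1 and Corollary 4.2: the `2`-valuation of the Gauss remainder -/

/-- `N(x+yi) = x² + y²` is even iff `x ≡ y (mod 2)`. [cite: Graves2025, §2 (p. 3)] -/
theorem two_dvd_norm_iff (b : ℤ√(-1)) : 2 ∣ b.norm ↔ (2 ∣ b.re ↔ 2 ∣ b.im) := by
  have h : b.norm = b.re * b.re + b.im * b.im := by rw [Zsqrtd.norm_def]; ring
  rw [h, ← even_iff_two_dvd, ← even_iff_two_dvd, ← even_iff_two_dvd, Int.even_add, Int.even_mul, Int.even_mul,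
    or_self, or_self]

/-- The bounds of `b ∈ B_{k+1}` that do not see the valuation: `|x|, |y| ≤ w_{k+1} − 2`, `|x| + |y| ≤ 2w_k − 3`.
[cite: Graves2025, Thm. 1.1 (p. 2)] -/
theorem abs_le_width_of_mem_digitSet_succ {b : ℤ√(-1)} {k : ℕ} (hb0 : b ≠ 0) (hb : b ∈ digitSet (k + 1)) :
    |b.re| ≤ width (k + 1) - 2 ∧ |b.im| ≤ width (k + 1) - 2 ∧ |b.re| + |b.im| ≤ 2 * width k - 3 := by
  have h := bounds_of_mem_digitSet (k := 0) hb hb0 (one_dvd _) (one_dvd _)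
  simp only [Int.natCast_natAbs, zero_add, pow_one, pow_zero, mul_one, width_add_two] at h
  exact h

/-- **Lemma 4.1, the case `v₂(r) = 0`**: a Gauss remainder `r` modulo `b ∈ B_{k+1} ∖ 0` whose coordinates are
not both even lies in `B_k` (i.e. `φ(r) < φ(b)`).  Proof (replacing the printed appeal to the equality rider of
Lemma 3.2): `ℓ∞(r) ≤ ℓ1(b)/2 ≤ w_k − 3/2` and `ℓ1(r) ≤ ℓ∞(b) ≤ w_{k+1} − 2`, where the last inequality is strict
unless `b` has both coordinates odd (then `ℓ∞(b)` is odd and `w_{k+1}` even) or `N(b)` is odd (then the open-square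
form of Lemma 3.2 applies) or `b` is even (then `ℓ∞(b) ≤ w_{k+1} − 4`). [cite: Graves2025, Lemma 4.1 (p. 4)] -/
theorem IsGaussRemainder.mem_digitSet_of_not_two_dvd {b r : ℤ√(-1)} {k : ℕ} (h : IsGaussRemainder b r)
    (hb0 : b ≠ 0) (hb : b ∈ digitSet (k + 1)) (hr : ¬(2 ∣ r.re ∧ 2 ∣ r.im)) : r ∈ digitSet k := by
  rw [mem_digitSet_iff_mem_octagon_of_not_two_dvd hr, mem_octagon_iff]
  simp only [Int.natCast_natAbs]
  obtain ⟨hx, hy, hxy⟩ := abs_le_width_of_mem_digitSet_succ hb0 hb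
  obtain ⟨h1, h2⟩ := h.oneNorm_le hb0
  unfold oneNorm supNorm at h1 h2
  have hg : |r.re| ≤ max |r.re| |r.im| := le_max_left _ _
  have hh : |r.im| ≤ max |r.re| |r.im| := le_max_right _ _
  have hw2 := two_dvd_width_succ k
  refine ⟨by omega, by omega, ?_⟩
  -- the `ℓ1` bound: `|g| + |h| ≤ max(|x|,|y|) ≤ w_{k+1} − 2`, with strictness somewhere
  by_cases heven : 2 ∣ b.re ∧ 2 ∣ b.im
  · -- `b` even: `ℓ∞(b) ≤ w_{k+1} − 4`
    have h4 := bounds_of_mem_digitSet (k := 1) hb hb0 (by simpa using heven.1) (by simpa using heven.2)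
    simp only [Int.natCast_natAbs] at h4
    rcases max_cases |b.re| |b.im| with ⟨hm, -⟩ | ⟨hm, -⟩ <;> omega
  by_cases hodd : 2 ∣ b.norm
  · -- both coordinates odd: `ℓ∞(b)` odd, `w_{k+1}` even
    rw [two_dvd_norm_iff] at hodd
    have hx1 : ¬ 2 ∣ b.re := fun h' ↦ heven ⟨h', hodd.mp h'⟩
    have hy1 : ¬ 2 ∣ b.im := fun h' ↦ heven ⟨hodd.mpr h', h'⟩
    rcases max_cases |b.re| |b.im| with ⟨hm, -⟩ | ⟨hm, -⟩ <;> rcases abs_cases b.re with ⟨ha, -⟩ | ⟨ha, -⟩ <;>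
      rcases abs_cases b.im with ⟨hb', -⟩ | ⟨hb', -⟩ <;> omega
  · -- `N(b)` odd: strict inequalities
    obtain ⟨h1', -⟩ := h.oneNorm_lt_of_odd_norm hodd
    unfold oneNorm supNorm at h1'
    rcases max_cases |b.re| |b.im| with ⟨hm, -⟩ | ⟨hm, -⟩ <;> omega

/-- A non-zero digit is a unit. [cite: Graves2025, §2 (p. 3)] -/
theorem isUnit_of_mem_digitSet_zero {b : ℤ√(-1)} (hb : b ∈ digitSet 0) (hb0 : b ≠ 0) : IsUnit b := by
  change b ∈ digits at hb
  rw [mem_digits_iff_natAbs] at hb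
  have hne : ¬(b.re = 0 ∧ b.im = 0) := fun h' ↦ hb0 (Zsqrtd.ext h'.1 h'.2)
  exact isUnit_of_natAbs_add_eq_one (by omega)

/-- **Lemma 4.1**: «If `a, b ∈ ℤ[i] ∖ {0}` have Gauss remainder `r` and `v₂(r) ≤ v₂(b)`, then
`φ_{ℤ[i]}(r) < φ_{ℤ[i]}(b)`» — here: `b ∈ B_{k+1} ⇒ r ∈ B_k` (reduction to `v₂(r) = 0` by dividing `b` and `r` by
`2^{v₂(r)}`, Lemma 3.1). [cite: Graves2025, Lemma 4.1 (p. 4)] -/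
theorem IsGaussRemainder.mem_digitSet_of_twoVal_le {b r : ℤ√(-1)} {k : ℕ} (h : IsGaussRemainder b r)
    (hb0 : b ≠ 0) (hb : b ∈ digitSet (k + 1)) (hv : twoVal r ≤ twoVal b) : r ∈ digitSet k := by
  by_cases hr0 : r = 0
  · rw [hr0]; exact zero_mem_digitSet k
  set v := twoVal r with hvdef
  obtain ⟨hbd1, hbd2⟩ := (pow_dvd_iff_le_twoVal hb0).mpr hv
  obtain ⟨b₀, hbb, hbre, hbim⟩ := eq_two_pow_mul hbd1 hbd2
  obtain ⟨r₀, hrr, hrre, hrim⟩ := eq_two_pow_mul (pow_twoVal_dvd r).1 (pow_twoVal_dvd r).2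
  have hP : (2 : ℤ√(-1)) ^ v ≠ 0 := pow_ne_zero _ (by decide)
  have hb₀0 : b₀ ≠ 0 := by rintro rfl; exact hb0 (by rw [hbb, mul_zero])
  have hr₀0 : r₀ ≠ 0 := by rintro rfl; exact hr0 (by rw [hrr, mul_zero])
  have hr₀odd : ¬(2 ∣ r₀.re ∧ 2 ∣ r₀.im) := by
    rintro ⟨⟨c, hc⟩, ⟨d, hd⟩⟩
    refine not_pow_twoVal_succ_dvd hr0 ⟨⟨c, ?_⟩, ⟨d, ?_⟩⟩
    · rw [hrre, hc, pow_succ]; ring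
    · rw [hrim, hd, pow_succ]; ring
  have hG : IsGaussRemainder b₀ r₀ := by rw [hbb, hrr, isGaussRemainder_mul_iff hP] at h; exact h
  -- `2v ≤ k + 1`, and `2v = k + 1` would make `b₀` a unit
  rcases Nat.lt_or_ge (k + 1) (2 * v) with hlt | hge
  · exact absurd hb (hbb ▸ two_pow_mul_not_mem_digitSet hb₀0 hlt)
  rcases Nat.eq_or_lt_of_le hge with heq | hlt
  · exfalso
    have hb₀ : b₀ ∈ digitSet 0 := by
      rw [hbb, show k + 1 = 0 + 2 * v by omega, two_pow_mul_mem_digitSet_iff] at hb; exact hb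
    exact hr₀0 (hG.eq_zero_of_isUnit (isUnit_of_mem_digitSet_zero hb₀ hb₀0))
  · obtain ⟨k', rfl⟩ : ∃ k', k = k' + 2 * v := ⟨k - 2 * v, by omega⟩
    have hb₀ : b₀ ∈ digitSet (k' + 1) := by
      rw [hbb, show k' + 2 * v + 1 = (k' + 1) + 2 * v by ring, two_pow_mul_mem_digitSet_iff] at hb; exact hb
    rw [hrr, two_pow_mul_mem_digitSet_iff]
    exact hG.mem_digitSet_of_not_two_dvd hb₀0 hb₀ hr₀odd

/-- Lemma 4.1 for `φ`: `φ(r) < φ(b)` when `v₂(r) ≤ v₂(b)` (`r ≠ 0` a Gauss remainder modulo `b ≠ 0`).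
[cite: Graves2025, Lemma 4.1 (p. 4)] -/
theorem IsGaussRemainder.motzkinNorm_lt_of_twoVal_le {b r : ℤ√(-1)} (h : IsGaussRemainder b r) (hb0 : b ≠ 0)
    (hr0 : r ≠ 0)
    (hv : twoVal r ≤ twoVal b) :
    motzkinNorm forall_exists_not_mem_motzkinSet r < motzkinNorm forall_exists_not_mem_motzkinSet b := by
  set n := motzkinNorm forall_exists_not_mem_motzkinSet b with hn
  have hbn : b ∈ digitSet n := mem_digitSet_motzkinNorm hb0
  have hbu : ¬IsUnit b := fun hu ↦ hr0 (h.eq_zero_of_isUnit hu)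
  -- `n ≥ 1` since `b` is not a unit (`B₀ = {0} ∪ units`)
  obtain ⟨k, hk⟩ : ∃ k, n = k + 1 := by
    rcases Nat.eq_zero_or_eq_succ_pred n with h0 | hS
    · exact absurd (isUnit_of_mem_digitSet_zero (h0 ▸ hbn) hb0) hbu
    · exact ⟨n - 1, hS⟩
  rw [hk] at hbn ⊢
  have := (motzkinNorm_le_iff_mem_digitSet hr0 k).mpr (h.mem_digitSet_of_twoVal_le hb0 hbn hv)
  omega

/-- `v₂(qb) ≥ v₂(b)`: `2^{v₂(b)}` divides both coordinates of `qb`. [cite: Graves2025, Cor. 4.2 (p. 4)] -/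
theorem pow_twoVal_dvd_mul (q b : ℤ√(-1)) : (2 : ℤ) ^ twoVal b ∣ (q * b).re ∧ (2 : ℤ) ^ twoVal b ∣ (q * b).im := by
  rw [← Zsqrtd.intCast_dvd]
  exact Dvd.dvd.mul_left ((Zsqrtd.intCast_dvd _ _).mpr (pow_twoVal_dvd b)) q

/-- **Corollary 4.2** (with the hypothesis corrected to a STRICT inequality): if `a = qb + r` with `r` a Gauss
remainder modulo `b ∈ B_{k+1} ∖ 0`, `a ≠ 0` and `v₂(a) < v₂(b)`, then `v₂(r) < v₂(b)` and so `r ∈ B_k`.  As printed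
(«`v₂(a) ≤ v₂(b)`») the corollary is false: `a = −177−177i`, `b = −12−11i` have Gauss quotient `15+i` and Gauss
remainder `r = −8` with `v₂(a) = v₂(b) = 0` but `φ(r) = φ(b) = 6`. [cite: Graves2025, Cor. 4.2 (p. 4)] -/
theorem IsGaussRemainder.mem_digitSet_of_twoVal_lt {a b q r : ℤ√(-1)} {k : ℕ} (h : IsGaussRemainder b r)
    (ha0 : a ≠ 0) (hb0 : b ≠ 0) (hb : b ∈ digitSet (k + 1)) (hdiv : a = q * b + r) (hv : twoVal a < twoVal b) :
    r ∈ digitSet k := by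
  by_cases hr0 : r = 0
  · rw [hr0]; exact zero_mem_digitSet k
  apply h.mem_digitSet_of_twoVal_le hb0 hb
  by_contra hlt
  rw [not_le] at hlt
  -- then `2^{v₂(b)}` divides `qb` and `r`, hence `a`
  obtain ⟨hr1, hr2⟩ := (pow_dvd_iff_le_twoVal hr0).mpr hlt.le
  obtain ⟨hq1, hq2⟩ := pow_twoVal_dvd_mul q b
  have ha : (2 : ℤ) ^ twoVal b ∣ a.re ∧ (2 : ℤ) ^ twoVal b ∣ a.im := by
    rw [hdiv, Zsqrtd.re_add, Zsqrtd.im_add]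
    exact ⟨dvd_add hq1 hr1, dvd_add hq2 hr2⟩
  exact absurd ((pow_dvd_iff_le_twoVal ha0).mp ha) (by omega)

/-- The printed counterexample to Corollary 4.2 with `≤`: `−177−177i = (15+i)(−12−11i) + (−8)`, the remainder `−8`
is a Gauss remainder, `v₂(−177−177i) = 0 = v₂(−12−11i)`, and `−8 ∉ B₅ ∌ −12−11i` while `−12−11i ∈ B₆`
(so `φ(−8) = 6 = φ(−12−11i)`). [cite: Graves2025, Cor. 4.2 (p. 4)] -/
theorem corollary_4_2_counterexample :
    (⟨-177, -177⟩ : ℤ√(-1)) = ⟨15, 1⟩ * ⟨-12, -11⟩ + ⟨-8, 0⟩ ∧ IsGaussRemainder ⟨-12, -11⟩ ⟨-8, 0⟩ ∧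
      twoVal ⟨-177, -177⟩ = 0 ∧ twoVal ⟨-12, -11⟩ = 0 ∧ (⟨-12, -11⟩ : ℤ√(-1)) ∈ digitSet 6 ∧
      (⟨-12, -11⟩ : ℤ√(-1)) ∉ digitSet 5 ∧ (⟨-8, 0⟩ : ℤ√(-1)) ∉ digitSet 5 := by
  have hv1 : twoVal ⟨-177, -177⟩ = 0 := (twoVal_eq_zero_iff (by decide)).mpr (by decide)
  have hv2 : twoVal ⟨-12, -11⟩ = 0 := (twoVal_eq_zero_iff (by decide)).mpr (by decide)
  have hv3 : twoVal (⟨-8, 0⟩ : ℤ√(-1)) = 3 := twoVal_eq (by decide) (by decide) (by decide)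
  refine ⟨by decide, ⟨by decide, by decide⟩, hv1, hv2, ?_, ?_, ?_⟩
  · rw [mem_digitSet_iff_supNorm_le (by decide), hv2]; decide
  · rw [not_mem_digitSet_iff_lt (by decide), hv2]; decide
  · rw [not_mem_digitSet_iff_lt (by decide), hv3]; decide

end Literature.NumberTheory.QuadraticFields.GaussianDigits
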